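import Summits.MatrixMultiplication.MatrixMultiplication.Theorems.SoloInformedValTwoBlock

/-!
# The mixed-radix two-block family: superlinear normal-form configurations in cyclic groups

Dossier `val-superlinear.md` (15.8)(i), claim c554.  `SoloInformedValTwoBlock` is the family of
[CKSU05, §7] in `(ZMod ℓ)³`.  The same two "rotated axis blocks" live in ANY product
`G = ZMod ℓ₁ × ZMod ℓ₂ × ZMod ℓ₃`: with `Lᵢ = ` the non-zero multiples of the `i`-th axis, the blocks
`L₁ × L₂ × L₃` and `L₂ × L₃ × L₁` (complete pair graphs inside each block, nothing across) form a
normal-form configuration WITHOUT ACCIDENTAL SOLUTIONS (`mixed_noAccidental`, the same eight-pattern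
argument), with `T = 2 (ℓ₁-1)(ℓ₂-1)(ℓ₃-1)` triangles (`card_mixed_triangleSet`) in a group of order
`ℓ₁ ℓ₂ ℓ₃` (`card_mixedGroup`).  Two consequences the cubic family does not give:

* `mixed457_superlinear` — for `(ℓ₁, ℓ₂, ℓ₃) = (4, 5, 7)` one gets `144` triangles in a group of order
  `140`, and `ZMod 4 × ZMod 5 × ZMod 7 ≃+ ZMod 140` is CYCLIC (`crt140`); transporting the potentials
  along this isomorphism (`NoAccidental.comp_of_injective`) gives `cyclic140_superlinear`: a superlinear
  normal-form configuration without accidental solutions in the cyclic group `ZMod 140` (the cubic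
  family needs `(ZMod 5)³`, order `125`, and never lives in a cyclic group);
* `mixed456_exact` — for `(4, 5, 6)` the two blocks have `60 + 60 = 120 = |G|` triangles: a packing
  with `T = |G|` EXACTLY that is not a single perfect block.

Elementary; recorded as kernel-certified members of the normal-form class (smallest orders with `T > |G|`
in this family: `125 = 5³`, then `140 = 4·5·7` (cyclic), `144 = 4·6·6`, `150`, `160`, …).
-/

namespace Summit.MatrixMultiplication.MatrixMultiplication.Theorems.SoloVal

open Finset

section Transport

variable {G G' : Type*} [AddCommGroup G] [AddCommGroup G']
variable {I J K : Type*} {x : I → G} {y : J → G} {z : K → G}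
variable {HIJ : Finset (I × J)} {HJK : Finset (J × K)} {HKI : Finset (K × I)}

/-- `NoAccidental` is transported along any injective additive homomorphism of the group. -/
theorem NoAccidental.comp_of_injective (h : NoAccidental x y z HIJ HJK HKI) (φ : G →+ G')
    (hφ : Function.Injective φ) : NoAccidental (φ ∘ x) (φ ∘ y) (φ ∘ z) HIJ HJK HKI := by
  intro i j j' k k' i' hij hjk hki hsum
  refine h i j j' k k' i' hij hjk hki (hφ ?_)
  rw [map_zero]
  simpa only [Function.comp, map_add, map_sub] using hsum

end Transport

section SameSide

variable (α β γ δ : Type*) [Fintype α] [Fintype β] [Fintype γ] [Fintype δ]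

/-- The pair graph "same side of the sum" between two classes indexed by sum types. -/
def sameSide : Finset ((α ⊕ β) × (γ ⊕ δ)) :=
  Finset.univ.filter (fun p => p.1.isLeft = p.2.isLeft)

variable {α β γ δ}

/-- Membership in the same-side graph. -/
theorem mem_sameSide {p : (α ⊕ β) × (γ ⊕ δ)} : p ∈ sameSide α β γ δ ↔ p.1.isLeft = p.2.isLeft := by
  simp [sameSide]

end SameSide

section TwoBlockMixed

variable (ℓ₁ ℓ₂ ℓ₃ : ℕ)

/-- The group `ZMod ℓ₁ × ZMod ℓ₂ × ZMod ℓ₃`. -/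
abbrev MixedGroup : Type := ZMod ℓ₁ × ZMod ℓ₂ × ZMod ℓ₃

/-- Non-zero digits modulo `m`. -/
abbrev NZDigit (m : ℕ) : Type := {u : ZMod m // u ≠ 0}

/-- Index classes: non-zero digits of one axis or of the next (`I = NZSum ℓ₁ ℓ₂`, `J = NZSum ℓ₂ ℓ₃`,
`K = NZSum ℓ₃ ℓ₁`; the summand records the block). -/
abbrev NZSum (a b : ℕ) : Type := NZDigit a ⊕ NZDigit b

/-- `x`-potentials. -/
def mxX : NZSum ℓ₁ ℓ₂ → MixedGroup ℓ₁ ℓ₂ ℓ₃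
  | Sum.inl u => (u.1, 0, 0)
  | Sum.inr u => (0, u.1, 0)

/-- `y`-potentials. -/
def mxY : NZSum ℓ₂ ℓ₃ → MixedGroup ℓ₁ ℓ₂ ℓ₃
  | Sum.inl v => (0, v.1, 0)
  | Sum.inr v => (0, 0, v.1)

/-- `z`-potentials. -/
def mxZ : NZSum ℓ₃ ℓ₁ → MixedGroup ℓ₁ ℓ₂ ℓ₃
  | Sum.inl w => (0, 0, w.1)
  | Sum.inr w => (w.1, 0, 0)

variable {ℓ₁ ℓ₂ ℓ₃}

/-- `x` on block one. -/
theorem mxX_inl (u : NZDigit ℓ₁) : mxX ℓ₁ ℓ₂ ℓ₃ (Sum.inl u) = (u.1, 0, 0) := rfl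
/-- `x` on block two. -/
theorem mxX_inr (u : NZDigit ℓ₂) : mxX ℓ₁ ℓ₂ ℓ₃ (Sum.inr u) = (0, u.1, 0) := rfl
/-- `y` on block one. -/
theorem mxY_inl (v : NZDigit ℓ₂) : mxY ℓ₁ ℓ₂ ℓ₃ (Sum.inl v) = (0, v.1, 0) := rfl
/-- `y` on block two. -/
theorem mxY_inr (v : NZDigit ℓ₃) : mxY ℓ₁ ℓ₂ ℓ₃ (Sum.inr v) = (0, 0, v.1) := rfl
/-- `z` on block one. -/
theorem mxZ_inl (w : NZDigit ℓ₃) : mxZ ℓ₁ ℓ₂ ℓ₃ (Sum.inl w) = (0, 0, w.1) := rfl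
/-- `z` on block two. -/
theorem mxZ_inr (w : NZDigit ℓ₁) : mxZ ℓ₁ ℓ₂ ℓ₃ (Sum.inr w) = (w.1, 0, 0) := rfl

/-- The parametrisation of the triangles: block one by three digits `(u, v, w)`, block two likewise. -/
def mxTri : (NZDigit ℓ₁ × NZDigit ℓ₂ × NZDigit ℓ₃) ⊕ (NZDigit ℓ₂ × NZDigit ℓ₃ × NZDigit ℓ₁) →
    NZSum ℓ₁ ℓ₂ × NZSum ℓ₂ ℓ₃ × NZSum ℓ₃ ℓ₁
  | Sum.inl q => (Sum.inl q.1, Sum.inl q.2.1, Sum.inl q.2.2)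
  | Sum.inr q => (Sum.inr q.1, Sum.inr q.2.1, Sum.inr q.2.2)

/-- The parametrisation is injective. -/
theorem mxTri_injective : Function.Injective (mxTri (ℓ₁ := ℓ₁) (ℓ₂ := ℓ₂) (ℓ₃ := ℓ₃)) := by
  rintro (⟨u, v, w⟩ | ⟨u, v, w⟩) (⟨u', v', w'⟩ | ⟨u', v', w'⟩) h
  · simp only [mxTri, Prod.mk.injEq, Sum.inl.injEq] at h
    obtain ⟨rfl, rfl, rfl⟩ := h; rfl
  · simp only [mxTri, Prod.mk.injEq] at h; exact absurd h.1 Sum.inl_ne_inr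
  · simp only [mxTri, Prod.mk.injEq] at h; exact absurd h.1 Sum.inr_ne_inl
  · simp only [mxTri, Prod.mk.injEq, Sum.inr.injEq] at h
    obtain ⟨rfl, rfl, rfl⟩ := h; rfl

variable [NeZero ℓ₁] [NeZero ℓ₂] [NeZero ℓ₃]

/-- NO ACCIDENTAL SOLUTIONS for the mixed-radix two-block family (all `ℓ₁, ℓ₂, ℓ₃ ≥ 1`). -/
theorem mixed_noAccidental :
    NoAccidental (mxX ℓ₁ ℓ₂ ℓ₃) (mxY ℓ₁ ℓ₂ ℓ₃) (mxZ ℓ₁ ℓ₂ ℓ₃)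
      (sameSide (NZDigit ℓ₁) (NZDigit ℓ₂) (NZDigit ℓ₂) (NZDigit ℓ₃))
      (sameSide (NZDigit ℓ₂) (NZDigit ℓ₃) (NZDigit ℓ₃) (NZDigit ℓ₁))
      (sameSide (NZDigit ℓ₃) (NZDigit ℓ₁) (NZDigit ℓ₁) (NZDigit ℓ₂)) := by
  intro i j j' k k' i' hij hjk hki hsum
  rcases i with u₁ | u₁ <;> rcases j with v₁ | v₁ <;>
    simp only [mem_sameSide, Sum.isLeft_inl, Sum.isLeft_inr, Bool.true_eq_false,
      Bool.false_eq_true] at hij <;>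
  rcases j' with v₂ | v₂ <;> rcases k with w₂ | w₂ <;>
    simp only [mem_sameSide, Sum.isLeft_inl, Sum.isLeft_inr, Bool.true_eq_false,
      Bool.false_eq_true] at hjk <;>
  rcases k' with w₃ | w₃ <;> rcases i' with u₃ | u₃ <;>
    simp only [mem_sameSide, Sum.isLeft_inl, Sum.isLeft_inr, Bool.true_eq_false,
      Bool.false_eq_true] at hki <;>
    (have hu₁ := u₁.2; have hv₁ := v₁.2; have hv₂ := v₂.2; have hw₂ := w₂.2; have hw₃ := w₃.2
     have hu₃ := u₃.2
     simp only [mxX_inl, mxX_inr, mxY_inl, mxY_inr, mxZ_inl, mxZ_inr, Prod.mk_sub_mk,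
       Prod.mk_add_mk, Prod.mk_eq_zero, sub_zero, zero_sub, add_zero, zero_add,
       sub_self, neg_eq_zero, add_neg_eq_zero, neg_add_eq_zero] at hsum
     obtain ⟨h1, h2, h3⟩ := hsum
     first
     | exact absurd h1 hw₃ | exact absurd h1 hu₃ | exact absurd h2 hu₁ | exact absurd h2 hv₁
     | exact absurd h3 hw₂ | exact absurd h3 hv₂
     | (refine ⟨?_, ?_, ?_⟩ <;>
         first | rw [Subtype.ext h1] | rw [Subtype.ext h2] | rw [Subtype.ext h3]))

/-- The triangles are the same-side triples. -/
theorem mem_mixed_triangleSet {τ : NZSum ℓ₁ ℓ₂ × NZSum ℓ₂ ℓ₃ × NZSum ℓ₃ ℓ₁} :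
    τ ∈ triangleSet (sameSide (NZDigit ℓ₁) (NZDigit ℓ₂) (NZDigit ℓ₂) (NZDigit ℓ₃))
        (sameSide (NZDigit ℓ₂) (NZDigit ℓ₃) (NZDigit ℓ₃) (NZDigit ℓ₁))
        (sameSide (NZDigit ℓ₃) (NZDigit ℓ₁) (NZDigit ℓ₁) (NZDigit ℓ₂)) ↔
      τ.1.isLeft = τ.2.1.isLeft ∧ τ.2.1.isLeft = τ.2.2.isLeft := by
  rw [mem_triangleSet, IsTriangle]
  simp only [mem_sameSide]
  constructor
  · rintro ⟨h1, h2, _⟩; exact ⟨h1, h2⟩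
  · rintro ⟨h1, h2⟩; exact ⟨h1, h2, (h1.trans h2).symm⟩

/-- The triangle set is the image of the parametrisation. -/
theorem mixed_triangleSet_eq :
    triangleSet (sameSide (NZDigit ℓ₁) (NZDigit ℓ₂) (NZDigit ℓ₂) (NZDigit ℓ₃))
        (sameSide (NZDigit ℓ₂) (NZDigit ℓ₃) (NZDigit ℓ₃) (NZDigit ℓ₁))
        (sameSide (NZDigit ℓ₃) (NZDigit ℓ₁) (NZDigit ℓ₁) (NZDigit ℓ₂)) =
      Finset.univ.image (mxTri (ℓ₁ := ℓ₁) (ℓ₂ := ℓ₂) (ℓ₃ := ℓ₃)) := by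
  ext τ
  rw [mem_mixed_triangleSet, Finset.mem_image]
  constructor
  · rintro ⟨h1, h2⟩
    obtain ⟨i, j, k⟩ := τ
    rcases i with u | u <;> rcases j with v | v <;> rcases k with w | w <;>
      simp only [Sum.isLeft_inl, Sum.isLeft_inr, Bool.true_eq_false, Bool.false_eq_true] at h1 h2
    · exact ⟨Sum.inl (u, v, w), Finset.mem_univ _, rfl⟩
    · exact ⟨Sum.inr (u, v, w), Finset.mem_univ _, rfl⟩
  · rintro ⟨q | q, -, rfl⟩ <;> exact ⟨rfl, rfl⟩

/-- `|G| = ℓ₁ ℓ₂ ℓ₃`. -/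
theorem card_mixedGroup : Fintype.card (MixedGroup ℓ₁ ℓ₂ ℓ₃) = ℓ₁ * ℓ₂ * ℓ₃ := by
  simp only [MixedGroup, Fintype.card_prod, ZMod.card]; ring

/-- `|NZSum a b| = (a - 1) + (b - 1)` (so `|I| = (ℓ₁-1)+(ℓ₂-1)`, `|J| = (ℓ₂-1)+(ℓ₃-1)`,
`|K| = (ℓ₃-1)+(ℓ₁-1)`). -/
theorem card_nzSum (a b : ℕ) [NeZero a] [NeZero b] : Fintype.card (NZSum a b) = (a - 1) + (b - 1) := by
  rw [Fintype.card_sum, card_nonzeroDigit, card_nonzeroDigit]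

/-- THE TRIANGLE COUNT: `T = 2 (ℓ₁-1)(ℓ₂-1)(ℓ₃-1)`. -/
theorem card_mixed_triangleSet :
    (triangleSet (sameSide (NZDigit ℓ₁) (NZDigit ℓ₂) (NZDigit ℓ₂) (NZDigit ℓ₃))
        (sameSide (NZDigit ℓ₂) (NZDigit ℓ₃) (NZDigit ℓ₃) (NZDigit ℓ₁))
        (sameSide (NZDigit ℓ₃) (NZDigit ℓ₁) (NZDigit ℓ₁) (NZDigit ℓ₂))).card =
      2 * ((ℓ₁ - 1) * (ℓ₂ - 1) * (ℓ₃ - 1)) := by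
  rw [mixed_triangleSet_eq, Finset.card_image_of_injective _ mxTri_injective, Finset.card_univ,
    Fintype.card_sum, Fintype.card_prod, Fintype.card_prod, Fintype.card_prod, Fintype.card_prod,
    card_nonzeroDigit, card_nonzeroDigit, card_nonzeroDigit]
  ring

/-- THE PACKAGED FAMILY STATEMENT: for all `ℓ₁, ℓ₂, ℓ₃ ≥ 1` a normal-form configuration without
accidental solutions in `ZMod ℓ₁ × ZMod ℓ₂ × ZMod ℓ₃` (order `ℓ₁ℓ₂ℓ₃`) with `2(ℓ₁-1)(ℓ₂-1)(ℓ₃-1)`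
triangles. -/
theorem mixed_summary :
    NoAccidental (mxX ℓ₁ ℓ₂ ℓ₃) (mxY ℓ₁ ℓ₂ ℓ₃) (mxZ ℓ₁ ℓ₂ ℓ₃)
        (sameSide (NZDigit ℓ₁) (NZDigit ℓ₂) (NZDigit ℓ₂) (NZDigit ℓ₃))
        (sameSide (NZDigit ℓ₂) (NZDigit ℓ₃) (NZDigit ℓ₃) (NZDigit ℓ₁))
        (sameSide (NZDigit ℓ₃) (NZDigit ℓ₁) (NZDigit ℓ₁) (NZDigit ℓ₂)) ∧
      Fintype.card (MixedGroup ℓ₁ ℓ₂ ℓ₃) = ℓ₁ * ℓ₂ * ℓ₃ ∧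
      (triangleSet (sameSide (NZDigit ℓ₁) (NZDigit ℓ₂) (NZDigit ℓ₂) (NZDigit ℓ₃))
          (sameSide (NZDigit ℓ₂) (NZDigit ℓ₃) (NZDigit ℓ₃) (NZDigit ℓ₁))
          (sameSide (NZDigit ℓ₃) (NZDigit ℓ₁) (NZDigit ℓ₁) (NZDigit ℓ₂))).card =
        2 * ((ℓ₁ - 1) * (ℓ₂ - 1) * (ℓ₃ - 1)) :=
  ⟨mixed_noAccidental, card_mixedGroup, card_mixed_triangleSet⟩

end TwoBlockMixed

section Instances

/-- `(4, 5, 7)`: `144` triangles in a group of order `140` — superlinear. -/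
theorem mixed457_superlinear :
    Fintype.card (MixedGroup 4 5 7) = 140 ∧
      (triangleSet (sameSide (NZDigit 4) (NZDigit 5) (NZDigit 5) (NZDigit 7))
          (sameSide (NZDigit 5) (NZDigit 7) (NZDigit 7) (NZDigit 4))
          (sameSide (NZDigit 7) (NZDigit 4) (NZDigit 4) (NZDigit 5))).card = 144 := by
  refine ⟨?_, ?_⟩
  · rw [card_mixedGroup]
  · rw [card_mixed_triangleSet]

/-- `(4, 5, 6)`: `120` triangles in a group of order `120` — a packing with `T = |G|` exactly by two
blocks of volume `60` each (not a single perfect block). -/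
theorem mixed456_exact :
    Fintype.card (MixedGroup 4 5 6) = 120 ∧
      (triangleSet (sameSide (NZDigit 4) (NZDigit 5) (NZDigit 5) (NZDigit 6))
          (sameSide (NZDigit 5) (NZDigit 6) (NZDigit 6) (NZDigit 4))
          (sameSide (NZDigit 6) (NZDigit 4) (NZDigit 4) (NZDigit 5))).card = 120 := by
  refine ⟨?_, ?_⟩
  · rw [card_mixedGroup]
  · rw [card_mixed_triangleSet]

/-- `(5, 5, 5)` recovers the cubic family's `128 > 125`; `(4, 6, 6)` gives `150 > 144`. -/
theorem mixed466_superlinear :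
    Fintype.card (MixedGroup 4 6 6) = 144 ∧
      (triangleSet (sameSide (NZDigit 4) (NZDigit 6) (NZDigit 6) (NZDigit 6))
          (sameSide (NZDigit 6) (NZDigit 6) (NZDigit 6) (NZDigit 4))
          (sameSide (NZDigit 6) (NZDigit 4) (NZDigit 4) (NZDigit 6))).card = 150 := by
  refine ⟨?_, ?_⟩
  · rw [card_mixedGroup]
  · rw [card_mixed_triangleSet]

/-- The Chinese remainder isomorphism `ZMod 140 ≃+ ZMod 4 × ZMod 5 × ZMod 7`: the group of
`mixed457_superlinear` is CYCLIC. -/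
def crt140 : ZMod 140 ≃+ MixedGroup 4 5 7 :=
  (ZMod.chineseRemainder (show Nat.Coprime 4 35 by norm_num)).toAddEquiv.trans
    (AddEquiv.prodCongr (AddEquiv.refl (ZMod 4))
      (ZMod.chineseRemainder (show Nat.Coprime 5 7 by norm_num)).toAddEquiv)

/-- SUPERLINEAR IN A CYCLIC GROUP: potentials valued in `ZMod 140` (the mixed `(4,5,7)` potentials
pulled back along `crt140`), no accidental solutions, `144 > 140 = |ZMod 140|` triangles. -/
theorem cyclic140_superlinear :
    NoAccidental ((crt140.symm : MixedGroup 4 5 7 →+ ZMod 140) ∘ mxX 4 5 7)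
        ((crt140.symm : MixedGroup 4 5 7 →+ ZMod 140) ∘ mxY 4 5 7)
        ((crt140.symm : MixedGroup 4 5 7 →+ ZMod 140) ∘ mxZ 4 5 7)
        (sameSide (NZDigit 4) (NZDigit 5) (NZDigit 5) (NZDigit 7))
        (sameSide (NZDigit 5) (NZDigit 7) (NZDigit 7) (NZDigit 4))
        (sameSide (NZDigit 7) (NZDigit 4) (NZDigit 4) (NZDigit 5)) ∧
      Fintype.card (ZMod 140) < (triangleSet (sameSide (NZDigit 4) (NZDigit 5) (NZDigit 5) (NZDigit 7))
          (sameSide (NZDigit 5) (NZDigit 7) (NZDigit 7) (NZDigit 4))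
          (sameSide (NZDigit 7) (NZDigit 4) (NZDigit 4) (NZDigit 5))).card := by
  refine ⟨mixed_noAccidental.comp_of_injective _ crt140.symm.injective, ?_⟩
  rw [mixed457_superlinear.2, ZMod.card]
  norm_num

end Instances

end Summit.MatrixMultiplication.MatrixMultiplication.Theorems.SoloVal
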